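import Summits.QuantumFields.YangMills.Theorems.AllWindowsColdBoxBoxHighLineGaussianNormalFormOnD
import Summits.QuantumFields.YangMills.Theorems.AllWindowsColdBoxBoxHighLineTiltNormTransferGauss
import Summits.QuantumFields.YangMills.Theorems.AllWindowsColdBoxBoxHighLineGaussCovMainReduction

/-!
# T-S5.13u — ✓13t `tiltSecondOrder` transported to the restricted Gaussian `μ_D` with the UNtruncated tilt exponent `tiltU β H`
# (a.e.-congruence of the tilt letters, truncation by an indicator, measurability of `tiltU`; ASSEMBLY-S5 §6; LINE-19 S5 ⟨stmt-QuantumFields-24004⟩)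

ASSEMBLY-S5 §6 runs the interpolation `f(t) = Tilt.tiltCov μ_D (tiltU β H) t c₀ c_T` and invokes ✓T-S5.13t (`tiltSecondOrder`, fcl-p3 g25), whose typed Prop demands
`Measurable U` and an EVERYWHERE bound `∀ x, |U x| ≤ B` on `Ω = (LandauFree H → E3)`; `tiltU β H` is bounded only ON `D = smallField H s` (w4's 13s (s6)).  This file
closes that gap (free-hands seat ym-line-fcl-p3 g26, announced 2026-08-29T20:4xZ):

* §1 (ns `…Tilt`) a.e.-congruence: `tiltExp_congr_ae`, `tiltCov_congr_ae`, `tiltCum3_congr_ae`, `tiltCum4_congr_ae` (`U =ᵐ[μ] U′`, `Gᵢ =ᵐ[μ] Gᵢ′`).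
* §2 (ns `…Tilt`) truncation: `indicator_ae_eq_of_ae_mem` (`∀ᵐ x ∂μ, x ∈ D ⇒ D.indicator U =ᵐ[μ] U`), `abs_indicator_le`, and
  ★`abs_tiltCov_sub_sub_tiltCum3_le_of_ae` — 13t under D-SUPPORT hypotheses (`μ` finite `≠ 0`, `∀ᵐ x ∂μ, x ∈ D`, `Measurable U G₁ G₂`, `|Gᵢ| ≤ B` everywhere,
  `|U| ≤ B` on `D`): `|tiltCov μ U 1 G₁ G₂ − tiltCov μ U 0 G₁ G₂ − tiltCum3 μ U 0 G₁ G₂| ≤ K/2` whenever `|tiltCum4 μ U t G₁ G₂| ≤ K` on `[0,1]`.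
* §3 (ns `…GaussNormalForm`) ★`measurable_tiltU` (with `measurable_cubicVertex`, `measurable_quarticWilson`, `measurable_divLinSq`, `measurable_ghostLogRatio`,
  `measurable_haarLogRatio`; LEAD's ✓`measurable_chartPlaqCost(Odd)`/`measurable_linCurvSq`, ✓`continuous_fpOperator_det`, ✓`continuous_landauPhi`,
  ✓`EdgeChart.measurable_edgeChart`, ✓`measurable_sigmaSU2_norm`).
* §4 ★★`abs_tiltCov_sub_sub_tiltCum3_le_muD` — 13t ON `μ_D := (volume.restrict (smallField H s)).withDensity (ofReal ∘ gaussWeight β H)` with `U = tiltU β H` VERBATIM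
  (`β > 0`, `s > 0`, measurable `Gᵢ` with `|Gᵢ| ≤ B`, `|tiltU| ≤ B` on `smallField H s`; w5's ✓`Tilt.ae_muD_mem_smallField`/`isFiniteMeasure_muD`, ✓13D `neZero_muD`).

Mathlib + tree; no definitions.  HONEST LABEL: plumbing for the T-S5.13 assembly of the XL stub S5 of a critic-PASSed DRAFT line; S5, U5, ⟨24004⟩ ⟨24335⟩ ⟨24336⟩ remain OPEN;
route AllWindowsColdBox is DRAFT; no rung is proved; **the Yang–Mills mass gap is NOT proved by this file; no summit is proved by a line.**  Seat ym-line-fcl-p3 g26 (cell ym-idea-1).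
-/

set_option autoImplicit false

noncomputable section

open MeasureTheory Set
open Literature.MathematicalPhysics.QuantumFieldTheory.Balaban1983to89.B10Eq18SigmaSU2Haar (measurable_sigmaSU2_norm)
open Literature.MathematicalPhysics.QuantumLattice (plaquettesTouching)
open Literature.MathematicalPhysics.QuantumFieldTheory.AxialGauge (boxEdges)

namespace Summit.QuantumFields.YangMills.Theorems.AllWindowsColdBoxBoxHighLine

/-! ## §1 A.e.-congruence of the tilt letters -/

namespace Tilt

section CongrAE

variable {Ω : Type*} [MeasurableSpace Ω] {μ : Measure Ω} {U U' : Ω → ℝ}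

/-- `tiltExp` only depends on the `μ`-a.e. classes of `U` and `G`. -/
theorem tiltExp_congr_ae (hU : U =ᵐ[μ] U') {G G' : Ω → ℝ} (hG : G =ᵐ[μ] G') (t : ℝ) : tiltExp μ U t G = tiltExp μ U' t G' := by
  unfold tiltExp
  have h1 : (fun x => G x * Real.exp (t * U x)) =ᵐ[μ] fun x => G' x * Real.exp (t * U' x) := by
    filter_upwards [hU, hG] with x hx hx'
    rw [hx, hx']
  have h2 : (fun x => Real.exp (t * U x)) =ᵐ[μ] fun x => Real.exp (t * U' x) := by
    filter_upwards [hU] with x hx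
    rw [hx]
  rw [integral_congr_ae h1, integral_congr_ae h2]

/-- `tiltCov` only depends on the a.e. classes. -/
theorem tiltCov_congr_ae (hU : U =ᵐ[μ] U') {G₁ G₁' G₂ G₂' : Ω → ℝ} (h₁ : G₁ =ᵐ[μ] G₁') (h₂ : G₂ =ᵐ[μ] G₂') (t : ℝ) :
    tiltCov μ U t G₁ G₂ = tiltCov μ U' t G₁' G₂' := by
  unfold tiltCov
  have h12 : (fun x => G₁ x * G₂ x) =ᵐ[μ] fun x => G₁' x * G₂' x := by
    filter_upwards [h₁, h₂] with x hx hx'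
    rw [hx, hx']
  rw [tiltExp_congr_ae hU h12 t, tiltExp_congr_ae hU h₁ t, tiltExp_congr_ae hU h₂ t]

/-- `tiltCum3` only depends on the a.e. classes. -/
theorem tiltCum3_congr_ae (hU : U =ᵐ[μ] U') {G₁ G₁' G₂ G₂' : Ω → ℝ} (h₁ : G₁ =ᵐ[μ] G₁') (h₂ : G₂ =ᵐ[μ] G₂') (t : ℝ) :
    tiltCum3 μ U t G₁ G₂ = tiltCum3 μ U' t G₁' G₂' := by
  unfold tiltCum3
  rw [tiltExp_congr_ae hU h₁ t, tiltExp_congr_ae hU h₂ t, tiltExp_congr_ae hU hU t]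
  refine tiltExp_congr_ae hU ?_ t
  filter_upwards [hU, h₁, h₂] with x hx h1x h2x
  rw [hx, h1x, h2x]

/-- `tiltCum4` only depends on the a.e. classes. -/
theorem tiltCum4_congr_ae (hU : U =ᵐ[μ] U') {G₁ G₁' G₂ G₂' : Ω → ℝ} (h₁ : G₁ =ᵐ[μ] G₁') (h₂ : G₂ =ᵐ[μ] G₂') (t : ℝ) :
    tiltCum4 μ U t G₁ G₂ = tiltCum4 μ U' t G₁' G₂' := by
  unfold tiltCum4
  rw [tiltExp_congr_ae hU h₁ t, tiltExp_congr_ae hU h₂ t, tiltExp_congr_ae hU hU t]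
  have hA : (fun x => (G₁ x - tiltExp μ U' t G₁') * (G₂ x - tiltExp μ U' t G₂') * (U x - tiltExp μ U' t U') ^ 2) =ᵐ[μ]
      fun x => (G₁' x - tiltExp μ U' t G₁') * (G₂' x - tiltExp μ U' t G₂') * (U' x - tiltExp μ U' t U') ^ 2 := by
    filter_upwards [hU, h₁, h₂] with x hx h1x h2x
    rw [hx, h1x, h2x]
  have hB : (fun x => (G₁ x - tiltExp μ U' t G₁') * (G₂ x - tiltExp μ U' t G₂')) =ᵐ[μ]
      fun x => (G₁' x - tiltExp μ U' t G₁') * (G₂' x - tiltExp μ U' t G₂') := by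
    filter_upwards [h₁, h₂] with x h1x h2x
    rw [h1x, h2x]
  have hC : (fun x => (U x - tiltExp μ U' t U') ^ 2) =ᵐ[μ] fun x => (U' x - tiltExp μ U' t U') ^ 2 := by
    filter_upwards [hU] with x hx
    rw [hx]
  have hD₁ : (fun x => (G₁ x - tiltExp μ U' t G₁') * (U x - tiltExp μ U' t U')) =ᵐ[μ]
      fun x => (G₁' x - tiltExp μ U' t G₁') * (U' x - tiltExp μ U' t U') := by
    filter_upwards [hU, h₁] with x hx h1x
    rw [hx, h1x]
  have hD₂ : (fun x => (G₂ x - tiltExp μ U' t G₂') * (U x - tiltExp μ U' t U')) =ᵐ[μ]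
      fun x => (G₂' x - tiltExp μ U' t G₂') * (U' x - tiltExp μ U' t U') := by
    filter_upwards [hU, h₂] with x hx h2x
    rw [hx, h2x]
  rw [tiltExp_congr_ae hU hA t, tiltExp_congr_ae hU hB t, tiltExp_congr_ae hU hC t, tiltExp_congr_ae hU hD₁ t, tiltExp_congr_ae hU hD₂ t]

end CongrAE

/-! ## §2 Truncation by an indicator, and 13t under support hypotheses -/

section Truncation

variable {Ω : Type*} [MeasurableSpace Ω] {μ : Measure Ω}

/-- If `μ`-a.e. point lies in `D`, the truncation `D.indicator U` agrees with `U` a.e. -/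
theorem indicator_ae_eq_of_ae_mem {D : Set Ω} (hD : ∀ᵐ x ∂μ, x ∈ D) (U : Ω → ℝ) : D.indicator U =ᵐ[μ] U := by
  filter_upwards [hD] with x hx
  exact Set.indicator_of_mem hx U

end Truncation

/-- The truncation is bounded everywhere by the bound of `U` on `D` (provided `0 ≤ B`). -/
theorem abs_indicator_le {Ω : Type*} {D : Set Ω} {U : Ω → ℝ} {B : ℝ} (hB : 0 ≤ B) (hUb : ∀ x ∈ D, |U x| ≤ B) (x : Ω) :
    |D.indicator U x| ≤ B := by
  by_cases hx : x ∈ D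
  · rw [Set.indicator_of_mem hx]; exact hUb x hx
  · rw [Set.indicator_of_notMem hx, abs_zero]; exact hB

/-- ★ **13t under D-support hypotheses.**  `μ` finite, `μ ≠ 0`, `μ`-a.e. point in the measurable set `D`; `U, G₁, G₂` measurable, `|Gᵢ| ≤ B` everywhere,
`|U| ≤ B` on `D`.  If `|κ₄,t| ≤ K` on `[0,1]` then `|Cov₁ − Cov₀ − κ₃,₀| ≤ K/2` — for the UNtruncated `U` (✓`tiltSecondOrder` applied to `D.indicator U`). -/
theorem abs_tiltCov_sub_sub_tiltCum3_le_of_ae {Ω : Type} [MeasurableSpace Ω] {μ : Measure Ω} [IsFiniteMeasure μ] [NeZero μ] {D : Set Ω}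
    (hDm : MeasurableSet D) (hD : ∀ᵐ x ∂μ, x ∈ D) {U G₁ G₂ : Ω → ℝ} (hU : Measurable U) (h₁ : Measurable G₁) (h₂ : Measurable G₂) {B : ℝ}
    (h₁b : ∀ x, |G₁ x| ≤ B) (h₂b : ∀ x, |G₂ x| ≤ B) (hUb : ∀ x ∈ D, |U x| ≤ B) {K : ℝ}
    (hK : ∀ t ∈ Set.Icc (0 : ℝ) 1, |tiltCum4 μ U t G₁ G₂| ≤ K) :
    |tiltCov μ U 1 G₁ G₂ - tiltCov μ U 0 G₁ G₂ - tiltCum3 μ U 0 G₁ G₂| ≤ K / 2 := by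
  have hae : D.indicator U =ᵐ[μ] U := indicator_ae_eq_of_ae_mem hD U
  have hB : 0 ≤ B := by
    rcases isEmpty_or_nonempty Ω with hΩ | ⟨⟨x⟩⟩
    · exfalso
      have : μ = 0 := Measure.eq_zero_of_isEmpty μ
      exact (NeZero.ne μ) this
    · exact (abs_nonneg _).trans (h₁b x)
  have hcov : ∀ t, tiltCov μ U t G₁ G₂ = tiltCov μ (D.indicator U) t G₁ G₂ := fun t =>
    (tiltCov_congr_ae hae Filter.EventuallyEq.rfl Filter.EventuallyEq.rfl t).symm
  have hc3 : ∀ t, tiltCum3 μ U t G₁ G₂ = tiltCum3 μ (D.indicator U) t G₁ G₂ := fun t =>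
    (tiltCum3_congr_ae hae Filter.EventuallyEq.rfl Filter.EventuallyEq.rfl t).symm
  have hc4 : ∀ t, tiltCum4 μ U t G₁ G₂ = tiltCum4 μ (D.indicator U) t G₁ G₂ := fun t =>
    (tiltCum4_congr_ae hae Filter.EventuallyEq.rfl Filter.EventuallyEq.rfl t).symm
  rw [hcov 1, hcov 0, hc3 0]
  refine tiltSecondOrder Ω μ (NeZero.ne μ) (D.indicator U) G₁ G₂ (hU.indicator hDm) h₁ h₂
    ⟨B, fun x => ⟨abs_indicator_le hB hUb x, h₁b x, h₂b x⟩⟩ K fun t ht => ?_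
  rw [← hc4 t]
  exact hK t ht

end Tilt

/-! ## §3 Measurability of the tilt exponent -/

namespace GaussNormalForm

variable (β : ℝ) (H : ℕ)

/-- The cubic vertex is measurable. -/
theorem measurable_cubicVertex : Measurable (cubicVertex β H) := by
  unfold cubicVertex
  exact (Finset.measurable_sum _ fun p _ => EdgeChartGaussian.measurable_chartPlaqCostOdd H p.1 p.2.1.1 p.2.1.2).const_mul β

/-- The even non-Gaussian Wilson part is measurable. -/
theorem measurable_quarticWilson : Measurable (quarticWilson β H) := by
  unfold quarticWilson
  refine (Finset.measurable_sum _ fun p _ => ?_).const_mul β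
  exact ((EdgeChartGaussian.measurable_chartPlaqCost H p.1 p.2.1.1 p.2.1.2).sub (EdgeChartGaussian.measurable_linCurvSq H _)).sub
    (EdgeChartGaussian.measurable_chartPlaqCostOdd H p.1 p.2.1.1 p.2.1.2)

/-- The linearised gauge-fixing form is measurable. -/
theorem measurable_divLinSq : Measurable (divLinSq H) := by
  unfold divLinSq divLin
  refine Finset.measurable_sum _ fun x _ => Finset.measurable_sum _ fun c _ => Measurable.pow_const ?_ 2
  unfold dotProduct colour
  exact Finset.measurable_sum _ fun e _ => (EdgeChartGaussian.measurable_coord e c).const_mul _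

/-- `Φ ∘ edgeChart` is measurable. -/
theorem measurable_landauPhi_edgeChart : Measurable fun a : LandauFree H → E3 => landauPhi H (edgeChart H a) :=
  (continuous_landauPhi H).measurable.comp (EdgeChart.measurable_edgeChart H)

/-- The ghost log-ratio is measurable. -/
theorem measurable_ghostLogRatio : Measurable (ghostLogRatio H) := by
  unfold ghostLogRatio
  exact (Real.measurable_log.comp (((continuous_fpOperator_det H).measurable.comp (EdgeChart.measurable_edgeChart H)).abs)).sub_const _

/-- The Haar log-ratio is measurable. -/
theorem measurable_haarLogRatio : Measurable (haarLogRatio H) := by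
  unfold haarLogRatio
  exact Finset.measurable_sum _ fun e _ => Real.measurable_log.comp ((measurable_sigmaSU2_norm.comp (measurable_pi_apply e)).div_const _)

/-- ★ **The tilt exponent `tiltU β H` is measurable.** -/
theorem measurable_tiltU : Measurable (tiltU β H) := by
  unfold tiltU
  exact ((((measurable_cubicVertex β H).neg.sub (measurable_quarticWilson β H)).sub
    ((measurable_landauPhi_edgeChart H).sub (measurable_divLinSq H) |>.const_mul β)).add (measurable_ghostLogRatio H)).add
    (measurable_haarLogRatio H)

/-! ## §4 13t on the restricted Gaussian `μ_D` -/

variable {β} {H}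

/-- ★★ **T-S5.13t ON `D`** (`μ_D := (volume.restrict (smallField H s)).withDensity (ofReal ∘ gaussWeight β H)`, `U = tiltU β H` verbatim):
for `β > 0`, `s > 0`, measurable `G₁, G₂` with `|Gᵢ| ≤ B` everywhere and `|tiltU β H| ≤ B` on `smallField H s`,
`(∀ t ∈ [0,1], |κ₄,t| ≤ K) → |Cov₁(G₁,G₂) − Cov₀(G₁,G₂) − κ₃,₀(G₁,G₂,tiltU)| ≤ K/2`. -/
theorem abs_tiltCov_sub_sub_tiltCum3_le_muD (hβ : 0 < β) {s : ℝ} (hs : 0 < s) {G₁ G₂ : (LandauFree H → E3) → ℝ} (h₁ : Measurable G₁)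
    (h₂ : Measurable G₂) {B : ℝ} (h₁b : ∀ a, |G₁ a| ≤ B) (h₂b : ∀ a, |G₂ a| ≤ B) (hUb : ∀ a ∈ smallField H s, |tiltU β H a| ≤ B) {K : ℝ}
    (hK : ∀ t ∈ Set.Icc (0 : ℝ) 1,
      |Tilt.tiltCum4 (((volume : Measure (LandauFree H → E3)).restrict (smallField H s)).withDensity fun a => ENNReal.ofReal (gaussWeight β H a))
        (tiltU β H) t G₁ G₂| ≤ K) :
    |Tilt.tiltCov (((volume : Measure (LandauFree H → E3)).restrict (smallField H s)).withDensity fun a => ENNReal.ofReal (gaussWeight β H a))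
          (tiltU β H) 1 G₁ G₂ -
        Tilt.tiltCov (((volume : Measure (LandauFree H → E3)).restrict (smallField H s)).withDensity fun a => ENNReal.ofReal (gaussWeight β H a))
          (tiltU β H) 0 G₁ G₂ -
        Tilt.tiltCum3 (((volume : Measure (LandauFree H → E3)).restrict (smallField H s)).withDensity fun a => ENNReal.ofReal (gaussWeight β H a))
          (tiltU β H) 0 G₁ G₂| ≤ K / 2 := by
  haveI := Tilt.isFiniteMeasure_muD H hβ s
  haveI := neZero_muD (H := H) hβ hs
  exact Tilt.abs_tiltCov_sub_sub_tiltCum3_le_of_ae (ChartGauss.measurableSet_smallField s) (Tilt.ae_muD_mem_smallField H β s)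
    (measurable_tiltU β H) h₁ h₂ h₁b h₂b hUb hK

end GaussNormalForm

end Summit.QuantumFields.YangMills.Theorems.AllWindowsColdBoxBoxHighLine

end
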